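import Summits.NavierStokesRegularity.NavierStokesRegularity.Theorems.ExtremiserTransienceNearExtremalTransienceExtremiserLiouvilleConstantSpeedJetAxialPairing
import HarnessLib

/-!
# Crux `ExtremiserTransience.NearExtremalTransience` (stmt-NavierStokesRegularity-21883), line `extremiser_liouville`,
# stub K1b — THE AXIAL PAIRING VANISHES IN THE BLOW-DOWN FOR EVERY RESIDUE (`L⁶` replaces the jet hypothesis)

`--supports stmt-NavierStokesRegularity-21883` (helper).  Author: prover seat `ns-el-k1b` (g6).  g5's
`tendsto_axial_pairing_rescale` (`…ConstantSpeedJetAxialPairing`) proves `R⁻²∫ V₂(x) G₂(R⁻¹x) dx → 0` for the deviation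
`V = v − c` of the residue in the JET alternative (slab energies `≤ (2N+1)E₀`).  Here the jet hypothesis is REMOVED: the
conclusion holds for every continuous `V` with `⟪V, c⟫ = −‖V‖²/2`, `c = (0,0,c₂) ≠ 0`, and `V ∈ L⁶` — and the residue's
deviation is in `L⁶` (g2, `exists_farFieldLimit`).  Mechanism: `|V₂| = ‖V‖²/(2|c₂|)`, and `R⁻²∫_{B(ρR)}‖V‖² → 0` for an `L⁶`
field: split at radius `R₀`; on the core `R⁻²∫_{B(R₀)}‖V‖² → 0`; on the tail use the pointwise bound
`‖V‖² ≤ ‖V‖⁶/(3θ²) + 2θ/3` with `θ = τ/R`: `R⁻²(∫_{‖x‖>R₀}‖V‖⁶ R²/(3τ²) + (2τ/3R)|B(ρR)|) = T(R₀)/(3τ²) + (2/3)τρ³|B₁|`, small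
for `τ` small and then `R₀` large (`T(R₀) = ∫_{‖x‖>R₀}‖V‖⁶ → 0`).

* `tendsto_integral_indicator_compl_closedBall` : the `L¹` tail of an integrable function vanishes.
* `tendsto_axial_pairing_rescale_of_memLp` : **`R⁻²∫ V₂(x) G₂(R⁻¹x) dx → 0`** for `V ∈ L⁶` continuous, `G ∈ C_c`.

Consequence (next file): g5's barycentre law `∫ v dμ = 0` and the vanishing of the blow-down vorticity hold for EVERY residue
object (flat or jet), not only for the jet.  WHAT THIS IS NOT: K1b is NOT proved; nothing here proves NS regularity. [folklore]
-/

noncomputable section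

open Set Filter Topology MeasureTheory Metric Function
open scoped ENNReal NNReal Topology InnerProductSpace RealInnerProductSpace
open Literature.Analysis.FluidPDE Literature.Analysis

namespace Summit.NavierStokesRegularity.NavierStokesRegularity.Theorems

-- the problem directory repeats the summit name (`NavierStokesRegularity/NavierStokesRegularity`)
set_option linter.dupNamespace false

namespace ExtremiserLiouville

variable {V : EuclideanSpace ℝ (Fin 3) → EuclideanSpace ℝ (Fin 3)} {c : EuclideanSpace ℝ (Fin 3)}

/-- **The `L¹` tail vanishes**: for `f` integrable, `∫ 1_{‖x‖ > n} f → 0` as `n → ∞` (dominated convergence). [folklore] -/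
theorem tendsto_integral_indicator_compl_closedBall {f : EuclideanSpace ℝ (Fin 3) → ℝ} (hf : Integrable f volume) :
    Tendsto (fun n : ℕ => ∫ x, (closedBall (0 : EuclideanSpace ℝ (Fin 3)) n)ᶜ.indicator f x) atTop (𝓝 0) := by
  have h := tendsto_integral_of_dominated_convergence (fun x => ‖f x‖)
    (F := fun (n : ℕ) x => (closedBall (0 : EuclideanSpace ℝ (Fin 3)) n)ᶜ.indicator f x) (f := fun _ => (0 : ℝ))
    (μ := volume) (fun n => (hf.indicator (measurableSet_closedBall.compl)).aestronglyMeasurable) hf.norm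
    (fun n => Eventually.of_forall fun x => norm_indicator_le_norm_self _ _) ?_
  · simpa using h
  · refine Eventually.of_forall fun x => tendsto_const_nhds.congr' ?_
    filter_upwards [tendsto_natCast_atTop_atTop.eventually_ge_atTop ‖x‖] with n hn
    have hx : x ∉ (closedBall (0 : EuclideanSpace ℝ (Fin 3)) n)ᶜ := by
      rw [mem_compl_iff, not_not, mem_closedBall, dist_zero_right]; exact hn
    rw [indicator_of_notMem hx]

/-- Pointwise Young-type bound: `a ≤ a³/(3θ²) + 2θ/3` for `a ≥ 0`, `θ > 0`. [folklore] -/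
theorem le_cube_div_add {a θ : ℝ} (ha : 0 ≤ a) (hθ : 0 < θ) : a ≤ a ^ 3 / (3 * θ ^ 2) + 2 * θ / 3 := by
  have h : 0 ≤ (a - θ) ^ 2 * (a + 2 * θ) := by positivity
  rw [div_add_div _ _ (by positivity) (by norm_num), le_div_iff₀ (by positivity)]
  nlinarith

/-- **The axial pairing vanishes in the blow-down, for `V ∈ L⁶`.**  `V` continuous with `⟪V, c⟫ = −‖V‖²/2`,
`c = (0,0,c₂) ≠ 0`, `V ∈ L⁶`; `G` continuous with compact support.  Then `R⁻²∫ V₂(x) G₂(R⁻¹x) dx → 0`. [folklore] -/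
theorem tendsto_axial_pairing_rescale_of_memLp (hV : Continuous V)
    (hVc : ∀ x, ⟪V x, c⟫ = -(‖V x‖ ^ 2 / 2)) (hc0 : c 0 = 0) (hc1 : c 1 = 0) (hc2 : c 2 ≠ 0)
    (hL6 : MemLp V 6 volume)
    {G : EuclideanSpace ℝ (Fin 3) → EuclideanSpace ℝ (Fin 3)} (hG : Continuous G) (hGc : HasCompactSupport G) :
    Tendsto (fun R : ℝ => R⁻¹ * R⁻¹ * ∫ x, V x 2 * G (R⁻¹ • x) 2) atTop (𝓝 0) := by
  have hc2' : 0 < |c 2| := abs_pos.2 hc2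
  -- constants of `G`
  obtain ⟨C, hC⟩ := hG.bounded_above_of_compact_support hGc
  have hC0 : 0 ≤ C := (norm_nonneg _).trans (hC 0)
  obtain ⟨ρ, hρ⟩ := (Metric.isBounded_iff_subset_closedBall (0 : EuclideanSpace ℝ (Fin 3))).1 hGc.isBounded
  set ρ₁ : ℝ := max ρ 1 with hρ₁
  have hρ₁pos : 0 < ρ₁ := lt_of_lt_of_le one_pos (le_max_right _ _)
  have hGρ : ∀ y, ρ₁ < ‖y‖ → G y = 0 := fun y hy => by
    refine image_eq_zero_of_notMem_tsupport fun h => ?_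
    have := hρ h
    rw [mem_closedBall, dist_zero_right] at this
    linarith [le_max_left ρ 1]
  set K : ℝ := C / (2 * |c 2|) with hK
  have hK0 : 0 ≤ K := by positivity
  set v₁ : ℝ := (volume (ball (0 : EuclideanSpace ℝ (Fin 3)) 1)).toReal with hv₁
  have hv₁0 : 0 ≤ v₁ := ENNReal.toReal_nonneg
  -- `‖V‖⁶ ∈ L¹`, and the squares are locally integrable
  have hI6 : Integrable (fun x => ‖V x‖ ^ 6) volume := by
    have h := hL6.integrable_norm_rpow (by norm_num) (by norm_num)
    refine h.congr (Eventually.of_forall fun x => ?_)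
    simp only [ENNReal.toReal_ofNat]
    exact_mod_cast Real.rpow_natCast ‖V x‖ 6
  -- the pointwise structure `|V₂| = ‖V‖²/(2|c₂|)`
  have hV2 : ∀ x, |V x 2| = ‖V x‖ ^ 2 / 2 / |c 2| := fun x => by
    rw [eq_div_iff hc2'.ne']; exact abs_axial_mul_eq hVc hc0 hc1 x
  rw [Metric.tendsto_atTop]
  intro ε hε
  -- choice of `τ`
  set τ : ℝ := ε / (3 * (K * ρ₁ ^ 3 * v₁ + 1)) with hτ
  have hτ0 : 0 < τ := by positivity
  have hτε : K * (2 / 3 * τ * ρ₁ ^ 3 * v₁) ≤ ε / 3 := by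
    have h0 : 0 ≤ K * ρ₁ ^ 3 * v₁ := by positivity
    have h1 : K * ρ₁ ^ 3 * v₁ / (K * ρ₁ ^ 3 * v₁ + 1) ≤ 1 := by
      rw [div_le_one (by positivity)]; linarith
    have h2 : 0 ≤ K * ρ₁ ^ 3 * v₁ / (K * ρ₁ ^ 3 * v₁ + 1) := by positivity
    have e : K * (2 / 3 * τ * ρ₁ ^ 3 * v₁) = (2 * ε / 9) * (K * ρ₁ ^ 3 * v₁ / (K * ρ₁ ^ 3 * v₁ + 1)) := by
      rw [hτ, div_mul_eq_mul_div, mul_div_assoc]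
      rw [show ε / (3 * (K * ρ₁ ^ 3 * v₁ + 1)) = (ε / 3) / (K * ρ₁ ^ 3 * v₁ + 1) by rw [div_div]]
      ring
    rw [e]
    nlinarith [mul_le_mul_of_nonneg_left h1 (by positivity : (0:ℝ) ≤ 2 * ε / 9)]
  -- choice of `R₀` (tail of `‖V‖⁶`)
  have htail := tendsto_integral_indicator_compl_closedBall hI6
  rw [Metric.tendsto_atTop] at htail
  obtain ⟨n₀, hn₀⟩ := htail (ε / 3 * (3 * τ ^ 2) / (K + 1)) (by positivity)
  set T : ℝ := ∫ x, (closedBall (0 : EuclideanSpace ℝ (Fin 3)) n₀)ᶜ.indicator (fun x => ‖V x‖ ^ 6) x with hT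
  have hT0 : 0 ≤ T := integral_nonneg fun x => indicator_nonneg (fun _ _ => by positivity) _
  have hTε : K * (T / (3 * τ ^ 2)) ≤ ε / 3 := by
    have h := hn₀ n₀ le_rfl
    rw [Real.dist_eq, sub_zero, abs_of_nonneg hT0] at h
    have hK1 : K ≤ K + 1 := by linarith
    calc K * (T / (3 * τ ^ 2)) ≤ (K + 1) * (T / (3 * τ ^ 2)) := mul_le_mul_of_nonneg_right hK1 (by positivity)
      _ ≤ (K + 1) * ((ε / 3 * (3 * τ ^ 2) / (K + 1)) / (3 * τ ^ 2)) :=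
          mul_le_mul_of_nonneg_left (div_le_div_of_nonneg_right h.le (by positivity)) (by positivity)
      _ = ε / 3 := by field_simp
  -- the core `∫_{B̄(R₀)} ‖V‖²`
  set Co : ℝ := ∫ x, (closedBall (0 : EuclideanSpace ℝ (Fin 3)) n₀).indicator (fun x => ‖V x‖ ^ 2) x with hCo
  have hCoi : Integrable (fun x => (closedBall (0 : EuclideanSpace ℝ (Fin 3)) n₀).indicator (fun x => ‖V x‖ ^ 2) x) volume := by
    refine ((hV.norm.pow 2).continuousOn.integrableOn_compact (isCompact_closedBall _ _)).integrable_indicator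
      measurableSet_closedBall
  have hCo0 : 0 ≤ Co := integral_nonneg fun x => indicator_nonneg (fun _ _ => by positivity) _
  -- choice of `R`
  refine ⟨max 1 (Real.sqrt (3 * K * Co / ε) + 1), fun R hR => ?_⟩
  have hR1 : 1 ≤ R := (le_max_left _ _).trans hR
  have hRpos : 0 < R := lt_of_lt_of_le one_pos hR1
  have hRcore : K * Co * (R⁻¹ * R⁻¹) < ε / 3 := by
    have hs : Real.sqrt (3 * K * Co / ε) < R := by linarith [(le_max_right _ _).trans hR]
    have h3 : 3 * K * Co / ε < R ^ 2 := (Real.sqrt_lt' hRpos).1 hs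
    rw [div_lt_iff₀ hε] at h3
    have hR2 : 0 < R * R := by positivity
    rw [show K * Co * (R⁻¹ * R⁻¹) = K * Co / (R * R) by field_simp, div_lt_iff₀ hR2]
    nlinarith
  -- the pointwise majorant
  set θ : ℝ := τ / R with hθ
  have hθ0 : 0 < θ := by positivity
  set maj : EuclideanSpace ℝ (Fin 3) → ℝ := fun x =>
    K * ((closedBall (0 : EuclideanSpace ℝ (Fin 3)) n₀).indicator (fun x => ‖V x‖ ^ 2) x +
      (closedBall (0 : EuclideanSpace ℝ (Fin 3)) n₀)ᶜ.indicator (fun x => ‖V x‖ ^ 6) x / (3 * θ ^ 2) +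
      2 * θ / 3 * (closedBall (0 : EuclideanSpace ℝ (Fin 3)) (ρ₁ * R)).indicator (fun _ => (1 : ℝ)) x) with hmaj
  have hind1 : Integrable (fun x => (closedBall (0 : EuclideanSpace ℝ (Fin 3)) (ρ₁ * R)).indicator (fun _ => (1 : ℝ)) x) volume := by
    rw [integrable_indicator_iff measurableSet_closedBall]
    exact integrableOn_const measure_closedBall_lt_top.ne
  have hmaji : Integrable maj volume :=
    ((hCoi.add ((hI6.indicator measurableSet_closedBall.compl).div_const _)).add (hind1.const_mul _)).const_mul _
  have hptw : ∀ x, |V x 2 * G (R⁻¹ • x) 2| ≤ maj x := by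
    intro x
    simp only [hmaj]
    have hm0 : 0 ≤ (closedBall (0 : EuclideanSpace ℝ (Fin 3)) n₀).indicator (fun x => ‖V x‖ ^ 2) x +
        (closedBall (0 : EuclideanSpace ℝ (Fin 3)) n₀)ᶜ.indicator (fun x => ‖V x‖ ^ 6) x / (3 * θ ^ 2) :=
      add_nonneg (indicator_nonneg (fun _ _ => by positivity) _)
        (div_nonneg (indicator_nonneg (fun _ _ => by positivity) _) (by positivity))
    by_cases hx : ρ₁ < ‖R⁻¹ • x‖
    · rw [hGρ _ hx]
      simp only [PiLp.zero_apply, mul_zero, abs_zero]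
      exact mul_nonneg hK0 (add_nonneg hm0 (mul_nonneg (by positivity) (indicator_nonneg (fun _ _ => zero_le_one) _)))
    · have hxB : x ∈ closedBall (0 : EuclideanSpace ℝ (Fin 3)) (ρ₁ * R) := by
        rw [mem_closedBall, dist_zero_right]
        rw [not_lt, norm_smul, Real.norm_eq_abs, abs_of_pos (inv_pos.2 hRpos)] at hx
        have h' := mul_le_mul_of_nonneg_right hx hRpos.le
        rwa [mul_comm R⁻¹ ‖x‖, inv_mul_cancel_right₀ hRpos.ne'] at h'
      have hG2 : |G (R⁻¹ • x) 2| ≤ C := by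
        rw [← Real.norm_eq_abs]; exact (PiLp.norm_apply_le (G (R⁻¹ • x)) 2).trans (hC _)
      -- `‖V‖² ≤ core + tail/(3θ²) + 2θ/3`
      have hsq : ‖V x‖ ^ 2 ≤ (closedBall (0 : EuclideanSpace ℝ (Fin 3)) n₀).indicator (fun x => ‖V x‖ ^ 2) x +
          (closedBall (0 : EuclideanSpace ℝ (Fin 3)) n₀)ᶜ.indicator (fun x => ‖V x‖ ^ 6) x / (3 * θ ^ 2) + 2 * θ / 3 := by
        by_cases hx0 : x ∈ closedBall (0 : EuclideanSpace ℝ (Fin 3)) n₀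
        · rw [indicator_of_mem hx0, indicator_of_notMem (Set.notMem_compl_iff.2 hx0), zero_div, add_zero]
          linarith
        · rw [indicator_of_notMem hx0, indicator_of_mem (mem_compl hx0), zero_add]
          have h := le_cube_div_add (sq_nonneg ‖V x‖) hθ0
          rw [← pow_mul] at h
          exact h
      rw [abs_mul, hV2 x, indicator_of_mem hxB, mul_one]
      calc ‖V x‖ ^ 2 / 2 / |c 2| * |G (R⁻¹ • x) 2| ≤ ‖V x‖ ^ 2 / 2 / |c 2| * C :=
            mul_le_mul_of_nonneg_left hG2 (by positivity)
        _ = K * ‖V x‖ ^ 2 := by rw [hK]; field_simp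
        _ ≤ K * _ := mul_le_mul_of_nonneg_left hsq hK0
  -- integrate
  have hvol : (volume (closedBall (0 : EuclideanSpace ℝ (Fin 3)) (ρ₁ * R))).toReal = (ρ₁ * R) ^ 3 * v₁ := by
    rw [Measure.addHaar_closedBall volume (0 : EuclideanSpace ℝ (Fin 3)) (by positivity : (0 : ℝ) ≤ ρ₁ * R),
      finrank_euclideanSpace, Fintype.card_fin, ENNReal.toReal_mul, ENNReal.toReal_ofReal (by positivity)]
  have hint : |∫ x, V x 2 * G (R⁻¹ • x) 2| ≤ K * (Co + T / (3 * θ ^ 2) + 2 * θ / 3 * ((ρ₁ * R) ^ 3 * v₁)) := by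
    refine (abs_integral_le_integral_abs).trans ((integral_mono_of_nonneg (Eventually.of_forall fun x => abs_nonneg _)
      hmaji (Eventually.of_forall hptw)).trans (le_of_eq ?_))
    have hA : Integrable (fun x => (closedBall (0 : EuclideanSpace ℝ (Fin 3)) n₀).indicator (fun x => ‖V x‖ ^ 2) x +
        (closedBall (0 : EuclideanSpace ℝ (Fin 3)) n₀)ᶜ.indicator (fun x => ‖V x‖ ^ 6) x / (3 * θ ^ 2)) volume :=
      hCoi.add ((hI6.indicator measurableSet_closedBall.compl).div_const _)
    have hB : Integrable (fun x => 2 * θ / 3 * (closedBall (0 : EuclideanSpace ℝ (Fin 3)) (ρ₁ * R)).indicator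
        (fun _ => (1 : ℝ)) x) volume := hind1.const_mul _
    have hI1 : (∫ x, (closedBall (0 : EuclideanSpace ℝ (Fin 3)) (ρ₁ * R)).indicator (fun _ => (1 : ℝ)) x) = (ρ₁ * R) ^ 3 * v₁ := by
      rw [integral_indicator measurableSet_closedBall, setIntegral_const, smul_eq_mul, mul_one, Measure.real, hvol]
    simp only [hmaj]
    rw [integral_const_mul, integral_add hA hB, integral_add hCoi ((hI6.indicator measurableSet_closedBall.compl).div_const _),
      integral_const_mul, integral_div, hI1]
  -- assemble
  rw [Real.dist_eq, sub_zero, abs_mul, abs_of_nonneg (by positivity : (0 : ℝ) ≤ R⁻¹ * R⁻¹)]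
  have e1 : R⁻¹ * R⁻¹ * (K * (T / (3 * θ ^ 2))) = K * (T / (3 * τ ^ 2)) := by
    rw [hθ]; field_simp
  have e2 : R⁻¹ * R⁻¹ * (K * (2 * θ / 3 * ((ρ₁ * R) ^ 3 * v₁))) = K * (2 / 3 * τ * ρ₁ ^ 3 * v₁) := by
    rw [hθ]; field_simp
  calc R⁻¹ * R⁻¹ * |∫ x, V x 2 * G (R⁻¹ • x) 2|
      ≤ R⁻¹ * R⁻¹ * (K * (Co + T / (3 * θ ^ 2) + 2 * θ / 3 * ((ρ₁ * R) ^ 3 * v₁))) :=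
        mul_le_mul_of_nonneg_left hint (by positivity)
    _ = K * Co * (R⁻¹ * R⁻¹) + R⁻¹ * R⁻¹ * (K * (T / (3 * θ ^ 2))) + R⁻¹ * R⁻¹ * (K * (2 * θ / 3 * ((ρ₁ * R) ^ 3 * v₁))) := by
        ring
    _ < ε / 3 + ε / 3 + ε / 3 := by rw [e1, e2]; exact add_lt_add_of_lt_of_le (add_lt_add_of_lt_of_le hRcore hTε) hτε
    _ = ε := by ring

end ExtremiserLiouville

end Summit.NavierStokesRegularity.NavierStokesRegularity.Theorems

end
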